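import Literature.Topology.FourManifolds.CappellShanesonClassGroupTwelve
import Literature.Topology.FourManifolds.CappellShanesonThmBWindow
import HarnessLib

/-!
# Kim–Yamada's Corollary C ⇐ Theorem B on the traces `[13, 69]` and Gompf's three leaves (fact split)

Topic `Literature/Topology/FourManifolds`. Fact-decomposition file (librarian, mode
`fact-decompose`, 2026-08-16) for the named fact
`Literature.Topology.FourManifolds.kimYamada2023_nonempty_diffeomorph_sphere_four_of_trace_mem_Icc`
(`CappellShaneson.lean`; M. H. Kim, S. Yamada, Kyungpook Math. J. 63 (2023) 373–411 =
arXiv:1707.03860, **Thm. B with Remark 1.1 / Cor. C**: Cappell–Shaneson spheres of matrices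
`A ∈ SL(3, ℤ)`, `det (A − 1) = 1`, `−64 ≤ tr A ≤ 69` are diffeomorphic to `S⁴`).

The tree has PROVED the architecture of the printed proof:

* Cor. C ⇐ Thm. B (matrix form) + Gompf's reduction to the Akbulut–Kirby sphere
  (`kimYamada2023_nonempty_diffeomorph_sphere_four_of_trace_mem_Icc_of`,
  `CappellShanesonGompfEquivalence.lean`; `CappellShanesonGompfReduction.lean`), the reduction
  resting on three TOPOLOGICAL named facts already in the tree — `gompf2010_deltaMove` (Gompf 2010
  Thm. 2.1/§3), `gompf2010_akbulutKirby_framings` (Gompf 2010 Thm. 4.3), `akbulutKirby1979_sphere_four`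
  (Akbulut–Kirby 1979);
* Thm. A (`n ↦ 5 − n`, `CappellShanesonTraceSymmetry.lean`) and Thm. B for every trace
  `−64 ≤ n ≤ 12` (class number one / Aitchison–Rubinstein, the trace `−5` two-class fact now
  discharged), whence `kimYamada2023_…_of_Icc_thirteen` (`CappellShanesonClassGroupTwelve.lean`):
  **the named fact from Thm. B on `[13, 69]` and the three leaves**;
* and, trace by trace, Thm. B for `n ∈ [13, 26] ∪ {28} ∪ [30, 36] ∪ {39, 41, 44}`
  (one per-trace theorem in each of `CappellShanesonClassGroupThirteen.lean`, …,
  `CappellShanesonClassGroupFortyfour.lean`: certified ideal-class computations in `ℤ[Θₙ]`,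
  Latimer–MacDuffee–Taussky).

This file NAMES the remaining algebraic input as ONE child, `KimYamada2023_thmB_traces_13_69`
(Thm. B in matrix form for every trace in `[13, 69]`; written out, definitionally the hypothesis
`hB` of `…_of_Icc_thirteen`), and records the PROVED assembly from it and the three EXISTING
topological leaves. The child is a finite algebraic statement about `SL(3, ℤ)` (no manifolds) —
not a restatement of the parent; of its 57 traces, 25 are already theorems of the tree (listed
above), the other 32 (`27, 29, 37, 38, 40, 42, 43, 45–69`) are the MAGMA tables 2–6 of the paper
still to be certified.

**Update 2026-08-28 — THE CHILD IS DISCHARGED.** With the per-trace certified class-group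
computations for every `13 ≤ n ≤ 69` now in the tree (the last one, `n = 58` with class number
`36`, in `CappellShanesonClassGroupFiftyeight*.lean`; the window assembled in
`CappellShanesonThmBWindow.lean` as `forall_gompfConjectureForTrace_Icc_neg_sixtyfour_sixtynine`),
`KimYamada2023_thmB_traces_13_69_holds` below PROVES the child; the parent from Gompf's three
topological leaves alone is `kimYamada2023_nonempty_diffeomorph_sphere_four_of_trace_mem_Icc_of_leaves`
(`CappellShanesonThmBWindow.lean`), or `…_holds_of` fed with `KimYamada2023_thmB_traces_13_69_holds`.

## References

* M. H. Kim, S. Yamada, *Ideal classes and Cappell–Shaneson homotopy 4-spheres*, Kyungpook Math.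
  J. 63 (2023) 373–411 (arXiv:1707.03860): §1.2 (Thm. B, Remark 1.1, Cor. C), §6.1 (proof of
  Thm. B), Tables 2–6. [KimYamada2023]
* R. E. Gompf, Algebr. Geom. Topol. 10 (2010) 1665–1681: Thm. 2.1, §3, Thm. 4.3. [GompfAGT2010]
* S. Akbulut, R. Kirby, Topology 18 (1979) 75–81. [AkbulutKirby1979]
-/

noncomputable section

open Set
open scoped Manifold ContDiff MatrixGroups

namespace Literature.Topology.FourManifolds

/-- **Kim–Yamada 2023, Theorem B in matrix form, traces `13 ≤ n ≤ 69`.** For every integer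
`n ∈ [13, 69]` and every `A ∈ SL(3, ℤ)` with `det (A − 1) = 1` and `tr A = n`, `A` is Gompf
equivalent (`GompfEquiv`, Kim–Yamada Def. 2.18: the equivalence relation generated by
`SL(3, ℤ)`-conjugation and the moves `A ↦ Δᵏ A`, `A ↦ A Δᵏ` on matrices in standard form) to the
Akbulut–Kirby matrix `A₀ = akbulutKirbyMatrix`. Printed: Thm. B, "[every Cappell–Shaneson matrix is Gompf
equivalent to `A₀`] for trace `n` if `−64 ≤ n ≤ 69`", proved in §6.1 from the minimal
representatives of the ideal class monoids `C(ℤ[Θₙ])` (Tables 2–6, MAGMA), the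
Latimer–MacDuffee–Taussky correspondence and Lemma 6.1; the traces `[−64, 12]` are theorems of
the tree, and so are `n ∈ [13, 26] ∪ {28} ∪ [30, 36] ∪ {39, 41, 44}`
(the per-trace theorems of `CappellShanesonClassGroupThirteen.lean` … `…Fortyfour.lean`), so what
this child still asks for is the 32 traces `27, 29, 37, 38, 40, 42, 43, 45–69`. Definitionally
equal to the hypothesis `hB` (the tree's trace predicate of `CappellShanesonGompfEquivalence.lean`
on `[13, 69]`) of the tree's
`kimYamada2023_nonempty_diffeomorph_sphere_four_of_trace_mem_Icc_of_Icc_thirteen`.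
[cite: KimYamada2023, Thm. B (§1.2) and §6.1 with Tables 2–6] -/
def KimYamada2023_thmB_traces_13_69 : Prop :=
  ∀ n ∈ Icc (13 : ℤ) 69, ∀ A : SL(3, ℤ), ((A : Matrix (Fin 3) (Fin 3) ℤ) - 1).det = 1 →
    Matrix.trace (A : Matrix (Fin 3) (Fin 3) ℤ) = n → GompfEquiv A akbulutKirbyMatrix

universe u in
/-- **Assembly (fact split): Kim–Yamada's Cor. C from Thm. B on `[13, 69]` and Gompf's three
topological leaves** (`gompf2010_deltaMove`, `gompf2010_akbulutKirby_framings`,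
`akbulutKirby1979_sphere_four` — existing named facts of `CappellShanesonGompfReduction.lean`):
the tree's `kimYamada2023_nonempty_diffeomorph_sphere_four_of_trace_mem_Icc_of_Icc_thirteen`.
[cite: KimYamada2023, Thm. B, Remark 1.1 and Cor. C (§1.2, §6.1)] -/
theorem kimYamada2023_nonempty_diffeomorph_sphere_four_of_trace_mem_Icc_holds_of
    (hΔ : gompf2010_deltaMove.{u}) (h43 : gompf2010_akbulutKirby_framings.{0, 0})
    (hAK : akbulutKirby1979_sphere_four) (hB : KimYamada2023_thmB_traces_13_69) :
    kimYamada2023_nonempty_diffeomorph_sphere_four_of_trace_mem_Icc.{u} :=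
  kimYamada2023_nonempty_diffeomorph_sphere_four_of_trace_mem_Icc_of_Icc_thirteen hΔ h43 hAK hB


/-- **Kim–Yamada 2023, Theorem B in matrix form on `[13, 69]` — the child DISCHARGED**: every
`A ∈ SL(3, ℤ)` with `det (A − 1) = 1` and `13 ≤ tr A ≤ 69` is Gompf equivalent to `A₀`
(`forall_gompfConjectureForTrace_Icc_thirteen_sixtynine`, `CappellShanesonThmBWindow.lean`: the
tree's 57 per-trace certified ideal-class computations, Lemma 6.1, the exceptional chains, Theorem A).
[cite: KimYamada2023, Thm. B (§1.2) and §6.1 with Tables 2–6] -/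
theorem KimYamada2023_thmB_traces_13_69_holds : KimYamada2023_thmB_traces_13_69 :=
  forall_gompfConjectureForTrace_Icc_thirteen_sixtynine

end Literature.Topology.FourManifolds

end
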